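import Summits.ResolutionOfSingularities.ResolutionOfSingularities.Theorems.WildQuotientsWildQuotientResolutionS1aNodeAtlas
import Literature.AlgebraicGeometry.Resolution.BlowupsExistence
import Literature.AlgebraicGeometry.Resolution.BlowupsProperProofs
import Literature.AlgebraicGeometry.Resolution.BlowupsIntegral
import Literature.AlgebraicGeometry.Resolution.BlowupsEquivariant
import Literature.AlgebraicGeometry.Resolution.BlowupDisjointCentreSplitting

/-!
# S1a — H4c: the MOVE of the kill game = the equivariant blow-up of an admissible centre [OURS · L1 W4.5c · idea-2 g15]

NOT a statement of the manuscript; counted 0. AI-level work, weaker than expert review. H3-SCHEME memo (G4)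
(`h123/H3-SCHEME.md` §1–§3; plan-1 RULING 20:04:51Z (5); Q1 «accept `Vʼ := Bl_{𝒦 d}(V)` as THE coarse move»
endorsed by tri-1 20:38:53Z / tri-2 20:39:25Z, plan-1 ruling pending at typing time).

THE MOVE. Given an admissible centre `(𝒦, d)` on the `G`-model `V` (H4b `IsAdmissibleCentre`), the next model is
ANY blow-up `π : Vʼ → V` of the ideal sheaf `𝒦.ideal d` (tree `IsBlowup`, which EXISTS by tree `exists_isBlowup`),
with the LIFTED action (tree `IsBlowup.liftAction`, hypothesis `hρ` = H4b `comap_aut_eq_of_isAdmissibleCentre`).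
Everything global is the treeʼs, by name: `IsBlowup.isProper`, `IsBlowup.isBirational'`, `IsBlowup.isIntegral`,
`IsBlowup.isLocallyNoetherian`, `IsBlowup.liftAction_hom_comp(_comp)`.

* `liftActionOver ρ hπ hρ : ActionOver (π ≫ q) G` — the lifted action as an action over the base (PROVED);
* `MoveStep p` — the typed MOVE: admissible centre ⇒ `∃ Vʼ π ρʼ`, blow-up of `𝒦 d`, proper, birational,
  `Vʼ` integral and locally Noetherian, `π` equivariant, and `Vʼ` again carries a NODE ATLAS;
* the two OURS residues it is assembled from — `BlowupNodeAtlas p` ((G1): the blow-up is covered by node charts =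
  the coarse charts `Spec((𝒜ʼ[h_l⁻¹])_{(0,0)})` of H3 `ChartClause`, re-indexed by `S1aNodeReindex`; chart identity
  (G1b) via H4a `coarseChart`; cover (G1c); idle charts inherited) and `CentreNeBot p` ((R1): an admissible centre
  on an integral model is a non-zero ideal sheaf — ring core, PROVED in H4d: the degree-0 trace `𝒦_d` contains the
  non-zero-divisor `(f₀^k · v)^d`, `k` = the (T1) index, `v` a homogeneous unit of degree `-k•deg f₀`, `f₀` a
  non-zero-divisor by K1′);
* **`moveStep_of : BlowupNodeAtlas p → CentreNeBot p → MoveStep p`** — PROVED (the (G4) assembly).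
-/

set_option linter.dupNamespace false

noncomputable section

open CategoryTheory AlgebraicGeometry TopologicalSpace
open Literature.AlgebraicGeometry.Resolution Literature.AlgebraicGeometry.RelativeSpec
open Summit.ResolutionOfSingularities.ResolutionOfSingularities.Theorems.WildQuotientResolution.S1
open Summit.ResolutionOfSingularities.ResolutionOfSingularities.Theorems.WildQuotientResolution.S1.NodeAtlas

namespace Summit.ResolutionOfSingularities.ResolutionOfSingularities.Theorems.WildQuotientResolution.S1.MoveStep

universe u

/-! ## The lifted action over the base -/

section Lift

variable {V' V Y : Scheme.{u}} {π : V' ⟶ V} {q : V ⟶ Y} {I : V.IdealSheafData} {G : Type*} [Group G]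

/-- The action lifted to a blow-up of a `G`-stable centre, as an action over the base `Y` along `π ≫ q`
(tree `IsBlowup.liftAction` + `liftAction_hom_comp_comp`). -/
def liftActionOver (ρ : ActionOver q G) (hπ : IsBlowup π I) (hρ : ∀ g : G, I.comap (ρ.aut g).hom = I) :
    ActionOver (π ≫ q) G where
  aut := hπ.liftAction ρ.aut hρ
  aut_comp g := hπ.liftAction_hom_comp_comp ρ.aut hρ q ρ.aut_comp g

/-- `π` is equivariant for the lifted action. -/
theorem liftActionOver_aut_hom_comp (ρ : ActionOver q G) (hπ : IsBlowup π I)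
    (hρ : ∀ g : G, I.comap (ρ.aut g).hom = I) (g : G) :
    ((liftActionOver ρ hπ hρ).aut g).hom ≫ π = π ≫ (ρ.aut g).hom :=
  hπ.liftAction_hom_comp ρ.aut hρ g

end Lift

/-! ## The move and its two residues -/

/-- **(G1) Blow-up node atlas** — THE OURS CHART RESIDUE of the scheme glue: for a group `G` GENERATED BY `g₀`
(tri-2 20:52:41Z (J-G) / tri-1 20:53:21Z: the charts `D₊(h_l)` are only `⟨g₀⟩`-stable; for arbitrary `G` the
statement is false) and an admissible centre `(𝒦, d)`,
every blow-up `Vʼ` of `𝒦.ideal d` carries a node atlas for the lifted action (the coarse charts of the H3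
`ChartClause` nodes, re-indexed to `Π ZMod` gradings by `S1aNodeReindex`, identified with the affine blow-up
charts `Γ(V,O)[𝒦_d/b]` by H4a `coarseChart`, and covering `π⁻¹ O` by the normalised cover (G1c); over an IDLE
chart `π` is an isomorphism and the node chart is inherited). [OURS · L1 W4.5c] -/
def BlowupNodeAtlas (p : ℕ) : Prop :=
  ∀ (V Y : Scheme.{u}) (q : V ⟶ Y) (G : Type u) [Group G] (ρ : ActionOver q G) (g₀ : G)
    (_ : ∀ g : G, g ∈ Subgroup.zpowers g₀)
    (𝒦 : ReesFiltration V) (d : ℕ) (h𝒦 : IsAdmissibleCentre p ρ g₀ 𝒦 d)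
    (V' : Scheme.{u}) (π : V' ⟶ V) (hπ : IsBlowup π (𝒦.ideal d)),
    NodeAtlas p (liftActionOver ρ hπ (comap_aut_eq_of_isAdmissibleCentre h𝒦)) g₀

/-- **(R1) An admissible centre on an integral model is a non-zero ideal sheaf.** [OURS · L1 W4.5c] -/
def CentreNeBot (p : ℕ) : Prop :=
  ∀ (V Y : Scheme.{u}) (q : V ⟶ Y) (G : Type u) [Group G] (ρ : ActionOver q G) (g₀ : G)
    (𝒦 : ReesFiltration V) (d : ℕ), IsIntegral V → IsAdmissibleCentre p ρ g₀ 𝒦 d → 𝒦.ideal d ≠ ⊥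

/-- **The MOVE of the kill game** (typed): for `G` generated by `g₀` (J-G), an admissible centre `(𝒦, d)` on an
integral locally Noetherian `G`-model `V` over `Y` yields `π : Vʼ → V`, a blow-up of `𝒦.ideal d`, proper and birational, with `Vʼ` integral
and locally Noetherian, an action `ρʼ` of `G` on `Vʼ` over `Y` making `π` equivariant, and a NODE ATLAS on `Vʼ`.
[OURS · L1 W4.5c] -/
def MoveStep (p : ℕ) : Prop :=
  ∀ (V Y : Scheme.{u}) (q : V ⟶ Y) (G : Type u) [Group G] (ρ : ActionOver q G) (g₀ : G),
    (∀ g : G, g ∈ Subgroup.zpowers g₀) →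
    ∀ (𝒦 : ReesFiltration V) (d : ℕ), IsIntegral V → IsLocallyNoetherian V → IsAdmissibleCentre p ρ g₀ 𝒦 d →
    ∃ (V' : Scheme.{u}) (π : V' ⟶ V) (ρ' : ActionOver (π ≫ q) G),
      IsBlowup π (𝒦.ideal d) ∧ IsProper π ∧ IsBirational π ∧ IsIntegral V' ∧ IsLocallyNoetherian V' ∧
      (∀ g : G, (ρ'.aut g).hom ≫ π = π ≫ (ρ.aut g).hom) ∧ NodeAtlas p ρ' g₀

/-- **(G4) MOVE ASSEMBLY**: the move follows from the chart residue (G1) and the non-vanishing (R1); existence,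
properness, birationality, integrality, local Noetherianity and equivariance are the treeʼs blow-up library. -/
theorem moveStep_of {p : ℕ} (hcharts : BlowupNodeAtlas.{u} p) (hne : CentreNeBot.{u} p) : MoveStep.{u} p := by
  intro V Y q G _ ρ g₀ hG 𝒦 d hV hN h𝒦
  obtain ⟨V', π, hπ⟩ := exists_isBlowup V (𝒦.ideal d)
  have hJ : 𝒦.ideal d ≠ ⊥ := hne V Y q G ρ g₀ 𝒦 d hV h𝒦
  exact ⟨V', π, liftActionOver ρ hπ (comap_aut_eq_of_isAdmissibleCentre h𝒦), hπ, hπ.isProper,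
    hπ.isBirational' hJ, hπ.isIntegral hJ, hπ.isLocallyNoetherian,
    liftActionOver_aut_hom_comp ρ hπ _, hcharts V Y q G ρ g₀ hG 𝒦 d h𝒦 V' π hπ⟩

end Summit.ResolutionOfSingularities.ResolutionOfSingularities.Theorems.WildQuotientResolution.S1.MoveStep

end
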